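import Summits.QuantumAdvantage.AdviceFreeQNC0.JuntaSizeTwist39
import Summits.QuantumAdvantage.AdviceFreeQNC0.HardcoreWordsGen39
import Summits.QuantumAdvantage.AdviceFreeQNC0.SeedJuntaRestricted39
import HarnessLib

/-!
# Cell qa-qnc0, `p = 3` — (R1) for scattered juntas of BOUNDED SIZE with ARBITRARY OVERLAPS (fibre method + Viola–Wigderson on
# each kernel-line fibre; prover qn-prover-3 g25)

`R1OneFibre39` / `R1PairMass39` settle (R1) `TwistedJunta36.TwistedJuntaBoundX3S` whenever the outside reads `T k ∖ W` admit a large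
transversal (one outside letter; pairwise disjoint; bounded multiplicity; small pair mass).  This file settles the complementary regime of
BOUNDED SIZE with arbitrary overlaps and multiplicities: on a kernel-line fibre, once the `W`-coins are fixed, the win sign of bells
reading `≤ w` outside letters is `(−1)^Q` with `Q` an `𝔽₂`-polynomial of degree `≤ max w 1` in the remaining coins, and the tree's
Viola–Wigderson bound for an arbitrary linear form modulo `3` (`TwoModuli.norm_sum_mul_stdAddChar_linear_le`, packaged for junta products
in `AffBells23.norm_sum_juntaProduct_mul_char_le_of_size`) gives the factor `exp(−3/(8·4^{max w 1}))` per twisted coin outside `W`; the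
hard-core sum with light weight `η = 2·exp(−3/(8·4^{max w 1}))` is `AffBells22.total_le_two_gen`.

* `AffBells22.norm_fibre_twist_le_juntaSize` — per-fibre bound `2^{#coins}·exp(−3·#{twisted coins ∉ W}/(8·4^{max w 1}))`;
* `AffBells22.norm_twist_sum_le_juntaSize` — the signed odd-class sum: `≤ (5/ρ_w)·ρ_w^{#(supp γ ∖ W)}·2^{N−1}`,
  `ρ_w = (7 + exp(−3/(8·4^{max w 1})))/8 < 1`;
* **`AffBells22.norm_twistedWinSum_le_juntaSize`** — `‖Σ_x e₃(β·x)[OddZeros x ∧ Rel x (g x)]‖ ≤ 3·ρ_w^{#(supp β ∖ W)}·2^N` for EVERY `W`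
  and every strategy whose bell `k` reads `W` and at most `w` further letters (ANY overlaps, `N ≥ 3`);
* **`GradedSeeds38.twistedJuntaBoundX3S_of_juntaSize`** — the statement of (R1) VERBATIM with `ρ = ρ_{w₀}` and the one extra hypothesis
  `#(T k ∖ W) ≤ w₀` (every `C`; `A = 1`, `n₀ = 3`);
* **`GradedSeeds38.seedJuntaHardXS_of_juntaSize`** — hence (via `seedJuntaHard_of_restrictedR1`) the STRUCTURED BRANCH (graded-spread
  seeds ⊕ juntas with `≤ w₀` outside letters, arbitrary overlaps) UNCONDITIONALLY: `≤ θ·2^{N−1}` winning odd inputs, one `θ < 1`, every `C`.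

Together with `R1PairMass39`: (R1) is now OPEN ONLY for outside reads of UNBOUNDED size `(log₂N)^C`, `C ≥ 1`, AND unbounded multiplicity with
dense overlaps — where each fibre carries a polylog-degree `𝔽₂`-polynomial against a MOD₃ character (beyond `exp(−n/4^d)`).

WHAT THIS IS NOT: nothing for junta size growing with `N`; crux `stmt-QuantumAdvantage-22907` untouched.
-/

noncomputable section

namespace Summit.QuantumAdvantage.AdviceFreeQNC0

open Finset Literature.Computability.QuantumComplexity Literature.Computability.QuantumComplexity.RingHLF
open Literature.Computability.MetaComplexity
open scoped Classical

namespace AffBells22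

variable {N : ℕ}

/-- Removing the coins of `W` from a coin set leaves at most `#(Tb ∖ W)` coins. -/
theorem card_coinSet_sdiff_coinPre_le (J : Fin N → Bool) (Tb W : Finset (Fin N)) :
    (coinSet J Tb \ coinPre J W).card ≤ (Tb \ W).card := by
  have hsub : coinSet J Tb \ coinPre J W = (Tb \ W).subtype (fun i => i ∉ act J) := by
    ext p
    simp only [mem_sdiff, coinSet, coinPre, mem_filter, mem_univ, true_and, mem_subtype]
  rw [hsub, card_subtype]
  exact card_filter_le _ _

/-- **PER-FIBRE TWIST BOUND, JUNTAS OF BOUNDED OUTSIDE SIZE**: for tables `y_k` reading `T_k` with `#(T_k ∖ W) ≤ w`,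
`‖Σ_{x odd, J(x) = J} (−1)^{⟨J, stake(y,x)⟩} ω^{⟨γ,x⟩}‖ ≤ 2^{#coins(J)} · exp(−3·#{coins i ∉ W : γ_i ≠ 0}/(8·4^{max w 1}))`
(`AffBells23.norm_sum_juntaProduct_mul_char_le_of_size` on the fibre in place of LEMMA JPD). -/
theorem norm_fibre_twist_le_juntaSize (hN : 3 ≤ N) {x₀ : Fin N → Bool} (hx₀ : Fib19.IsOdd x₀) (T : Fin N → Finset (Fin N))
    (y : Fin N → (Fin N → Bool) → Bool) (hy : ∀ k, ReadsOnly (T k) (y k))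
    (γ : Fin N → ZMod 3) (W : Finset (Fin N)) {w : ℕ} (hT : ∀ k, (T k \ W).card ≤ w) :
    ‖∑ x ∈ ((univ : Finset (Fin N → Bool)).filter fun x => Fib19.IsOdd x).filter
        (fun x => Fib19.kline x = Fib19.kline x₀),
        (-1 : ℂ) ^ dot2 (Fib19.kline x) (Fib19.stake (fun x k => y k x) x)
          * (ZMod.stdAddChar (∑ i : Fin N, if x i then γ i else 0) : ℂ)‖
      ≤ (2 : ℝ) ^ Fintype.card {i // i ∉ act (Fib19.kline x₀)} *
          Real.exp (-(3 * ((univ.filter fun p : {i // i ∉ act (Fib19.kline x₀)} => p.val ∉ W ∧ γ p.val ≠ 0).card : ℝ)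
            / (8 * 4 ^ (max w 1)))) := by
  set J := Fib19.kline x₀ with hJ
  have hrw : ∑ x ∈ ((univ : Finset (Fin N → Bool)).filter fun x => Fib19.IsOdd x).filter (fun x => Fib19.kline x = J),
      (-1 : ℂ) ^ dot2 (Fib19.kline x) (Fib19.stake (fun x k => y k x) x)
        * (ZMod.stdAddChar (∑ i : Fin N, if x i then γ i else 0) : ℂ)
      = ∑ x ∈ ((univ : Finset (Fin N → Bool)).filter fun x => Fib19.IsOdd x).filter (fun x => Fib19.kline x = J),
      (-1 : ℂ) ^ dot2 J (Fib19.stake (fun x k => y k x) x)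
        * (ZMod.stdAddChar (∑ i : Fin N, if x i then γ i else 0) : ℂ) := by
    refine sum_congr rfl fun x hx => ?_
    rw [(mem_filter.mp hx).2]
  rw [hrw, sum_fibre_eq hN hx₀]
  -- the pieces on the fibre
  set S₀ : ({i // i ∉ act J} → Bool) → ℂ := fun v =>
    ∏ b ∈ act J, (sgnB ((gv J v) b) * sgnB ((gv J v) (nxt b))) with hS₀
  set h : Fin N → ({i // i ∉ act J} → Bool) → ℂ := fun b v => sgnB (y b (gv J v)) with hh
  set P : ({i // i ∉ act J} → Bool) → ℂ := fun v => ∏ i : Fin N, sgnB (!(gv J v) i) with hP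
  have hS₀c : IsCoordProduct S₀ := isCoordProduct_fibreSign₀ J
  have hPc : IsCoordProduct P := isCoordProduct_zerosSign J
  have hpm : ∀ b ∈ act J, ∀ v, h b v = 1 ∨ h b v = -1 := fun b _ v => sgnB_cases _
  have hread : ∀ b ∈ act J, AffBells23.ReadsOn (coinSet J (T b)) (h b) :=
    fun b _ => readsOn_sgnB_junta J (T b) (y b) (hy b)
  have hW' : ∀ b ∈ act J, (coinSet J (T b) \ coinPre J W).card ≤ w :=
    fun b _ => (card_coinSet_sdiff_coinPre_le J (T b) W).trans (hT b)
  set cA : ℂ := (ZMod.stdAddChar (∑ k : {i // i ∈ act J}, if forced J k then γ k else 0) : ℂ) with hcA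
  set γ' : {i // i ∉ act J} → ZMod 3 := fun k => γ k with hγ'
  have hterm : ∀ v : {i // i ∉ act J} → Bool,
      (if Fib19.IsOdd (gv J v) then (-1 : ℂ) ^ dot2 J (Fib19.stake (fun x k => y k x) (gv J v))
          * (ZMod.stdAddChar (∑ i : Fin N, if gv J v i then γ i else 0) : ℂ) else 0)
        = cA / 2 * ((S₀ v * ∏ b ∈ act J, h b v) * (ZMod.stdAddChar (∑ k, if v k then γ' k else 0) : ℂ))
          - cA / 2 * (((P v * S₀ v) * ∏ b ∈ act J, h b v)
              * (ZMod.stdAddChar (∑ k, if v k then γ' k else 0) : ℂ)) := by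
    intro v
    have hind := isOdd_indicator_eq (gv J v)
    rw [char_split, AddChar.map_add_eq_mul, fibreSign_eq_prod]
    by_cases ho : Fib19.IsOdd (gv J v)
    · rw [if_pos ho] at hind ⊢
      have hP1 : P v = -1 := by
        have : (1 : ℂ) = (1 - P v) / 2 := hind
        linear_combination 2 * this
      rw [hP1]; simp only [hS₀, hh, hcA, hγ']; ring
    · rw [if_neg ho] at hind ⊢
      have hP1 : P v = 1 := by
        have : (0 : ℂ) = (1 - P v) / 2 := hind
        linear_combination 2 * this
      rw [hP1]; ring
  rw [sum_congr rfl fun v _ => hterm v, sum_sub_distrib, ← mul_sum, ← mul_sum]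
  have hB := AffBells23.norm_sum_juntaProduct_mul_char_le_of_size (act J) (fun b => coinSet J (T b)) h hpm hread hS₀c γ'
    (coinPre J W) hW'
  have hB' := AffBells23.norm_sum_juntaProduct_mul_char_le_of_size (act J) (fun b => coinSet J (T b)) h hpm hread
    (hPc.mul hS₀c) γ' (coinPre J W) hW'
  have hfilt : (univ.filter fun p : {i // i ∉ act J} => p ∉ coinPre J W ∧ γ' p ≠ 0)
      = (univ.filter fun p : {i // i ∉ act J} => p.val ∉ W ∧ γ p.val ≠ 0) := by
    ext p
    simp only [mem_filter, mem_univ, true_and, coinPre, hγ']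
  rw [hfilt] at hB hB'
  have hcAn : ‖cA / 2‖ = 1 / 2 := by
    rw [norm_div, hcA, AffBells21.norm_stdAddChar_three]; simp
  set X := (2 : ℝ) ^ Fintype.card {i // i ∉ act J} *
    Real.exp (-(3 * ((univ.filter fun p : {i // i ∉ act J} => p.val ∉ W ∧ γ p.val ≠ 0).card : ℝ) / (8 * 4 ^ (max w 1))))
    with hX
  calc ‖cA / 2 * ∑ v, (S₀ v * ∏ b ∈ act J, h b v) * (ZMod.stdAddChar (∑ k, if v k then γ' k else 0) : ℂ)
        - cA / 2 * ∑ v, ((P v * S₀ v) * ∏ b ∈ act J, h b v) * (ZMod.stdAddChar (∑ k, if v k then γ' k else 0) : ℂ)‖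
      ≤ ‖cA / 2 * ∑ v, (S₀ v * ∏ b ∈ act J, h b v) * (ZMod.stdAddChar (∑ k, if v k then γ' k else 0) : ℂ)‖
        + ‖cA / 2 * ∑ v, ((P v * S₀ v) * ∏ b ∈ act J, h b v)
            * (ZMod.stdAddChar (∑ k, if v k then γ' k else 0) : ℂ)‖ := norm_sub_le _ _
    _ ≤ 1 / 2 * X + 1 / 2 * X := by
        rw [norm_mul, norm_mul, hcAn]
        exact add_le_add (mul_le_mul_of_nonneg_left hB (by norm_num)) (mul_le_mul_of_nonneg_left hB' (by norm_num))
    _ = X := by ring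

/-- The per-fibre bound as a word weight: `2^{#zeros(J)}·e^{#(zeros(J) ∩ D)} = Π_{J_i = 0} (i ∈ D ? 2e : 2)`. -/
theorem two_pow_mul_pow_eq_wordWt (J : Fin N → Bool) (D : Finset (Fin N)) (e : ℝ) :
    (2 : ℝ) ^ Fintype.card {i // i ∉ act J} * e ^ (univ.filter fun p : {i // i ∉ act J} => p.val ∈ D).card
      = wordWt (fun n => if n ∈ D.map Fin.valEmbedding then 2 * e else 2) J := by
  set Z := univ.filter (fun i : Fin N => J i = false) with hZ
  have hcard : Fintype.card {i // i ∉ act J} = Z.card := by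
    rw [Fintype.card_subtype]
    congr 1
    ext i; simp [act, hZ]
  have hcardD : (univ.filter fun p : {i // i ∉ act J} => p.val ∈ D).card = (Z.filter fun i => i ∈ D).card := by
    have e1 : (univ.filter fun p : {i // i ∉ act J} => p.val ∈ D) = D.subtype (fun i => i ∉ act J) := by
      ext p; simp [mem_subtype]
    rw [e1, card_subtype]
    congr 1
    ext i; simp [act, hZ, and_comm]
  rw [hcard, hcardD]
  unfold wordWt
  rw [← prod_filter_mul_prod_filter_not univ (fun i : Fin N => J i = false)]
  have h2 : ∏ i ∈ univ.filter (fun i : Fin N => ¬ J i = false),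
      (if J i = false then (fun n : ℕ => if n ∈ D.map Fin.valEmbedding then 2 * e else 2) i.val else 1) = 1 :=
    prod_eq_one fun i hi => by rw [if_neg (mem_filter.mp hi).2]
  rw [h2, mul_one, ← hZ]
  have h3 : ∏ i ∈ Z, (if J i = false then (fun n : ℕ => if n ∈ D.map Fin.valEmbedding then 2 * e else 2) i.val else 1)
      = ∏ i ∈ Z, (if i ∈ D then 2 * e else (2 : ℝ)) := by
    refine prod_congr rfl fun i hi => ?_
    rw [if_pos (mem_filter.mp hi).2]
    have hmem : (i.val ∈ D.map Fin.valEmbedding) ↔ i ∈ D := by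
      rw [show (i.val : ℕ) = Fin.valEmbedding i from rfl, Finset.mem_map']
    simp only [hmem]
  rw [h3, prod_ite, prod_const, prod_const]
  have hsplit : Z.card = (Z.filter fun i => i ∈ D).card + (Z.filter fun i => ¬ i ∈ D).card :=
    (card_filter_add_card_filter_not (s := Z) (fun i => i ∈ D)).symm
  rw [hsplit, pow_add, mul_pow]
  ring

/-- `#D ≤ #((D.map val) ∩ [1, m]) + 1` for `D ⊆ Fin (m+1)` (only position `0` can be lost). -/
theorem rho_pow_filter_le {ρ : ℝ} (hρ0 : 0 < ρ) (hρ1 : ρ ≤ 1) {m : ℕ} (D : Finset (Fin (m + 1))) :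
    ρ ^ ((D.map Fin.valEmbedding).filter fun i => 1 ≤ i ∧ i ≤ m).card ≤ ρ⁻¹ * ρ ^ D.card := by
  have hc := card_supp_le_filter_succ D
  set c := ((D.map Fin.valEmbedding).filter fun i => 1 ≤ i ∧ i ≤ m).card with hcdef
  have h1 : ρ ^ c ≤ ρ ^ (D.card - 1) := pow_le_pow_of_le_one hρ0.le hρ1 (by omega)
  refine h1.trans ?_
  rcases Nat.eq_zero_or_pos D.card with hz | hpos
  · rw [hz]; simp
    exact (one_le_inv₀ hρ0).mpr hρ1
  · have : ρ ^ D.card = ρ * ρ ^ (D.card - 1) := by rw [← pow_succ']; congr 1; omega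
    rw [this, ← mul_assoc, inv_mul_cancel₀ hρ0.ne', one_mul]

/-- **THE TWIST BOUND FOR JUNTAS OF BOUNDED OUTSIDE SIZE** (signed odd-class sum): bells reading `T k` with `#(T k ∖ W) ≤ w`, any `W`,
any overlaps: `‖Σ_{x odd} (−1)^{⟨J(x), stake(y,x)⟩} ω^{⟨γ,x⟩}‖ ≤ (5/ρ_w)·ρ_w^{#{i ∉ W : γ_i ≠ 0}}·2^{N−1}`,
`ρ_w = (7 + exp(−3/(8·4^{max w 1})))/8`. -/
theorem norm_twist_sum_le_juntaSize (hN : 3 ≤ N) (T : Fin N → Finset (Fin N)) (y : Fin N → (Fin N → Bool) → Bool)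
    (hy : ∀ k, ReadsOnly (T k) (y k)) (γ : Fin N → ZMod 3) (W : Finset (Fin N)) {w : ℕ} (hT : ∀ k, (T k \ W).card ≤ w) :
    ‖∑ x ∈ (univ : Finset (Fin N → Bool)).filter (fun x => Fib19.IsOdd x),
        (-1 : ℂ) ^ dot2 (Fib19.kline x) (Fib19.stake (fun x k => y k x) x)
          * (ZMod.stdAddChar (∑ i : Fin N, if x i then γ i else 0) : ℂ)‖
      ≤ 5 * ((7 + Real.exp (-(3 / (8 * 4 ^ (max w 1))))) / 8)⁻¹ *
          ((7 + Real.exp (-(3 / (8 * 4 ^ (max w 1))))) / 8) ^ (univ.filter fun i : Fin N => i ∉ W ∧ γ i ≠ 0).card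
            * (2 : ℝ) ^ (N - 1) := by
  obtain ⟨m, rfl⟩ : ∃ m, N = m + 1 := ⟨N - 1, by omega⟩
  set e : ℝ := Real.exp (-(3 / (8 * 4 ^ (max w 1)))) with he
  set ρ : ℝ := (7 + e) / 8 with hρ
  have he0 : 0 < e := Real.exp_pos _
  have he1 : e ≤ 1 := by rw [he]; exact Real.exp_le_one_iff.mpr (by rw [neg_nonpos]; positivity)
  have hρ0 : 0 < ρ := by rw [hρ]; positivity
  have hρ1 : ρ ≤ 1 := by rw [hρ]; linarith
  set D := univ.filter (fun i : Fin (m + 1) => i ∉ W ∧ γ i ≠ 0) with hDdef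
  set wgt : ℕ → ℝ := fun n => if n ∈ D.map Fin.valEmbedding then 2 * e else 2 with hwgt
  set O := (univ : Finset (Fin (m + 1) → Bool)).filter (fun x => Fib19.IsOdd x) with hO
  set Φ : (Fin (m + 1) → Bool) → ℂ := fun x => (-1 : ℂ) ^ dot2 (Fib19.kline x) (Fib19.stake (fun x k => y k x) x)
      * (ZMod.stdAddChar (∑ i : Fin (m + 1), if x i then γ i else 0) : ℂ) with hΦ
  have hmaps : ∀ x ∈ O, Fib19.kline x ∈ O.image Fib19.kline := fun x hx => mem_image_of_mem _ hx
  rw [← sum_fiberwise_of_maps_to hmaps]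
  -- per-fibre bound as a word weight
  have hfib : ∀ J ∈ O.image Fib19.kline, ‖∑ x ∈ O.filter (fun x => Fib19.kline x = J), Φ x‖ ≤ wordWt wgt J := by
    intro J hJ
    obtain ⟨x₀, hx₀, rfl⟩ := mem_image.mp hJ
    have h := norm_fibre_twist_le_juntaSize hN (mem_filter.mp hx₀).2 T y hy γ W hT
    refine h.trans (le_of_eq ?_)
    rw [← two_pow_mul_pow_eq_wordWt (Fib19.kline x₀) D e]
    congr 1
    have hfilt : (univ.filter fun p : {i // i ∉ act (Fib19.kline x₀)} => p.val ∉ W ∧ γ p.val ≠ 0)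
        = (univ.filter fun p : {i // i ∉ act (Fib19.kline x₀)} => p.val ∈ D) := by
      ext p; simp [hDdef]
    rw [hfilt, he, ← Real.exp_nat_mul]
    congr 1
    ring
  have hsub : O.image Fib19.kline ⊆ univ.filter (fun v : Fin (m + 1) → Bool => NoAdj v) := by
    intro J hJ
    obtain ⟨x₀, hx₀, rfl⟩ := mem_image.mp hJ
    exact mem_filter.mpr ⟨mem_univ _, noAdj_of_hardCore (Fib19.kline_hardCore hN x₀ (mem_filter.mp hx₀).2)⟩
  have hw0 : ∀ i, 0 ≤ wgt i := fun i => by simp only [hwgt]; split_ifs <;> positivity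
  have hw2 : ∀ i, wgt i ≤ 2 := fun i => by simp only [hwgt]; split_ifs <;> linarith
  have hL : ∀ i ∈ D.map Fin.valEmbedding, wgt i ≤ 2 * e := fun i hi => by simp only [hwgt, if_pos hi]; exact le_rfl
  have h2e0 : 0 ≤ 2 * e := by positivity
  have h2e2 : 2 * e ≤ 2 := by linarith
  have h3 := total_le_two_gen wgt hw0 hw2 (D.map Fin.valEmbedding) h2e0 h2e2 hL m
  have hρ' : ((14 + 2 * e) / 16 : ℝ) = ρ := by rw [hρ]; ring
  rw [hρ'] at h3
  have hκ := rho_pow_filter_le hρ0 hρ1 D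
  rw [Nat.add_sub_cancel]
  have h2q : (0 : ℝ) ≤ 2 ^ m := by positivity
  calc ‖∑ J ∈ O.image Fib19.kline, ∑ x ∈ O.filter (fun x => Fib19.kline x = J), Φ x‖
      ≤ ∑ J ∈ O.image Fib19.kline, ‖∑ x ∈ O.filter (fun x => Fib19.kline x = J), Φ x‖ := norm_sum_le _ _
    _ ≤ ∑ J ∈ O.image Fib19.kline, wordWt wgt J := sum_le_sum hfib
    _ ≤ ∑ v : Fin (m + 1) → Bool, (if NoAdj v then wordWt wgt v else 0) := by
        rw [← sum_filter]
        exact sum_le_sum_of_subset_of_nonneg hsub (fun v _ _ => wordWt_nonneg hw0 v)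
    _ ≤ _ := h3
    _ ≤ 5 * (ρ⁻¹ * ρ ^ D.card) * 2 ^ m := by gcongr
    _ = 5 * ρ⁻¹ * ρ ^ D.card * 2 ^ m := by ring

/-- The rate `ρ_w = (7 + exp(−3/(8·4^{max w 1})))/8` is `< 1`. -/
theorem rhoSize_lt_one (w : ℕ) : (7 + Real.exp (-(3 / (8 * 4 ^ (max w 1))))) / 8 < (1 : ℝ) := by
  have : Real.exp (-(3 / (8 * 4 ^ (max w 1)))) < 1 := Real.exp_lt_one_iff.mpr (by rw [neg_lt_zero]; positivity)
  linarith

/-- … and `≥ 39/40` (so the strategy-free term `(39/40)^{wt}` is absorbed): `exp(−3/32) ≥ 29/32`. -/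
theorem rhoSize_ge (w : ℕ) : (39 / 40 : ℝ) ≤ (7 + Real.exp (-(3 / (8 * 4 ^ (max w 1))))) / 8 := by
  have h1 : (1 : ℝ) ≤ 4 ^ (max w 1) := one_le_pow₀ (by norm_num)
  have h4 : (4 : ℝ) ≤ 4 ^ (max w 1) := by
    calc (4 : ℝ) = 4 ^ 1 := by norm_num
      _ ≤ 4 ^ (max w 1) := pow_le_pow_right₀ (by norm_num) (le_max_right _ _)
  have hx : -(3 / (8 * 4 ^ (max w 1)) : ℝ) ≥ -(3 / 32) := by
    rw [ge_iff_le, neg_le_neg_iff]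
    rw [div_le_div_iff₀ (by positivity) (by norm_num)]
    nlinarith
  have hexp : -(3 / (8 * 4 ^ (max w 1)) : ℝ) + 1 ≤ Real.exp (-(3 / (8 * 4 ^ (max w 1)))) := Real.add_one_le_exp _
  linarith

/-- **(R1) FOR SCATTERED JUNTAS OF BOUNDED SIZE, ARBITRARY OVERLAPS** (fibre method + Viola–Wigderson per fibre).  If bell `k` reads
only `T k` with `#(T k ∖ W) ≤ w` (`W` ARBITRARY, overlaps and multiplicities arbitrary), then
`‖Σ_x e₃(β·x)[OddZeros x ∧ Rel x (g x)]‖ ≤ 3·ρ_w^{#(supp β ∖ W)}·2^N`, `ρ_w = (7 + exp(−3/(8·4^{max w 1})))/8 < 1` (`N ≥ 3`). -/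
theorem norm_twistedWinSum_le_juntaSize (hN : 3 ≤ N) (W : Finset (Fin N)) (T : Fin N → Finset (Fin N))
    (g : Fin N → (Fin N → Bool) → Bool) (hg : ∀ k, ReadsOnly (T k) (g k)) {w : ℕ} (hT : ∀ k, (T k \ W).card ≤ w)
    (β : Fin N → ZMod 3) :
    ‖∑ x : Fin N → Bool, (ZMod.stdAddChar (∑ i : Fin N, if x i then β i else 0) : ℂ) *
        (if (OddZeros x ∧ RingHLF.Rel x (fun k => g k x)) then (1 : ℂ) else 0)‖
      ≤ 3 * ((7 + Real.exp (-(3 / (8 * 4 ^ (max w 1))))) / 8) ^ (univ.filter fun j : Fin N => j ∉ W ∧ β j ≠ 0).card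
          * (2 : ℝ) ^ N := by
  set ρ : ℝ := (7 + Real.exp (-(3 / (8 * 4 ^ (max w 1))))) / 8 with hρ
  have hρ39 : (39 / 40 : ℝ) ≤ ρ := rhoSize_ge w
  have hρ0 : 0 < ρ := lt_of_lt_of_le (by norm_num) hρ39
  have hρ1 : ρ ≤ 1 := (rhoSize_lt_one w).le
  set D := univ.filter (fun j : Fin N => j ∉ W ∧ β j ≠ 0) with hDdef
  set χ : (Fin N → Bool) → ℂ := fun x => (ZMod.stdAddChar (∑ i : Fin N, if x i then β i else 0) : ℂ) with hχ
  set s : (Fin N → Bool) → ℂ := fun x =>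
    (-1 : ℂ) ^ dot2 (Fib19.kline x) (Fib19.stake (fun x k => g k x) x) with hs
  set O := (univ : Finset (Fin N → Bool)).filter (fun x => Fib19.IsOdd x) with hO
  have hterm : ∀ x : Fin N → Bool,
      χ x * (if (OddZeros x ∧ RingHLF.Rel x (fun k => g k x)) then (1 : ℂ) else 0)
        = if Fib19.IsOdd x then (χ x - s x * χ x) / 2 else 0 := by
    intro x
    by_cases hx : Fib19.IsOdd x
    · have hox : OddZeros x := (Fib19.isOdd_iff_oddZeros x).mp hx
      rw [if_pos hx]
      have hw := win_indicator_eq hN (fun x k => g k x) x hx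
      have e : (if (OddZeros x ∧ RingHLF.Rel x (fun k => g k x)) then (1 : ℂ) else 0)
          = (if RingHLF.Rel x ((fun x k => g k x) x) then (1 : ℂ) else 0) := by
        simp only [hox, true_and]
      rw [e, hw]
      ring
    · have hox : ¬ OddZeros x := fun h => hx ((Fib19.isOdd_iff_oddZeros x).mpr h)
      rw [if_neg hx, if_neg (fun h => hox h.1), mul_zero]
  have hsplit : (∑ x : Fin N → Bool, χ x * (if (OddZeros x ∧ RingHLF.Rel x (fun k => g k x)) then (1 : ℂ) else 0))
      = ((∑ x ∈ O, χ x) - ∑ x ∈ O, s x * χ x) / 2 := by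
    rw [sum_congr rfl fun x _ => hterm x, ← sum_filter, ← sum_div, sum_sub_distrib]
  rw [hsplit, norm_div, RCLike.norm_ofNat]
  have h1 : ‖∑ x ∈ O, χ x‖ ≤ ρ ^ D.card * (2 : ℝ) ^ N := by
    refine ((norm_oddClass_char_le β).trans (prod_wt_le_pow β)).trans ?_
    have hDsub : D ⊆ univ.filter (fun i : Fin N => β i ≠ 0) := fun i hi => mem_filter.mpr ⟨mem_univ _, (mem_filter.mp hi).2.2⟩
    have hcard : D.card ≤ (univ.filter fun i : Fin N => β i ≠ 0).card := card_le_card hDsub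
    have hp1 : (39 / 40 : ℝ) ^ (univ.filter fun i : Fin N => β i ≠ 0).card ≤ (39 / 40 : ℝ) ^ D.card :=
      pow_le_pow_of_le_one (by norm_num) (by norm_num) hcard
    have hp2 : (39 / 40 : ℝ) ^ D.card ≤ ρ ^ D.card := pow_le_pow_left₀ (by norm_num) hρ39 _
    exact mul_le_mul_of_nonneg_right (hp1.trans hp2) (by positivity)
  have h2 : ‖∑ x ∈ O, s x * χ x‖ ≤ 5 * ρ⁻¹ * ρ ^ D.card * (2 : ℝ) ^ (N - 1) :=
    norm_twist_sum_le_juntaSize hN T g hg β W hT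
  have h2N : (2 : ℝ) ^ (N - 1) = 2 ^ N / 2 := by
    obtain ⟨m, rfl⟩ : ∃ m, N = m + 1 := ⟨N - 1, by omega⟩
    rw [Nat.add_sub_cancel, pow_succ]; ring
  rw [h2N] at h2
  have hρinv : ρ⁻¹ ≤ 40 / 39 := by
    rw [inv_le_comm₀ hρ0 (by norm_num)]; norm_num; exact hρ39
  have hpos : (0 : ℝ) ≤ ρ ^ D.card * (2 : ℝ) ^ N := by positivity
  calc ‖(∑ x ∈ O, χ x) - ∑ x ∈ O, s x * χ x‖ / 2
      ≤ (‖∑ x ∈ O, χ x‖ + ‖∑ x ∈ O, s x * χ x‖) / 2 := by gcongr; exact norm_sub_le _ _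
    _ ≤ (ρ ^ D.card * (2 : ℝ) ^ N + 5 * ρ⁻¹ * ρ ^ D.card * (2 ^ N / 2)) / 2 := by gcongr
    _ = (1 / 2 + 5 / 4 * ρ⁻¹) * (ρ ^ D.card * (2 : ℝ) ^ N) := by ring
    _ ≤ 3 * (ρ ^ D.card * (2 : ℝ) ^ N) := mul_le_mul_of_nonneg_right (by linarith) hpos
    _ = 3 * ρ ^ D.card * (2 : ℝ) ^ N := by ring

end AffBells22

namespace GradedSeeds38

open AffBells22

/-- **(R1) `TwistedJunta36.TwistedJuntaBoundX3S` for scattered juntas of BOUNDED SIZE** — the statement of (R1) verbatim with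
`ρ = ρ_{w₀} = (7 + exp(−3/(8·4^{max w₀ 1})))/8 < 1` (`AffBells22.rhoSize_lt_one`) and the one extra hypothesis `#(T k ∖ W) ≤ w₀` (arbitrary
overlaps and multiplicities; every `C`; `A = 1`, `n₀ = 3`; `3·#W ≤ N` unused). -/
theorem twistedJuntaBoundX3S_of_juntaSize (w₀ C : ℕ) :
    ∃ A n₀ : ℕ, ∀ N ≥ n₀,
      ∀ (W : Finset (Fin N)) (T : Fin N → Finset (Fin N)) (g : Fin N → (Fin N → Bool) → Bool),
        3 * W.card ≤ N → (∀ k, (T k \ W).card ≤ (Nat.log 2 N) ^ C) → (∀ k, (T k \ W).card ≤ w₀) →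
        (∀ k (x x' : Fin N → Bool), (∀ i ∈ T k, x i = x' i) → g k x = g k x') →
          ∀ β : Fin N → ZMod 3,
            ‖∑ x : Fin N → Bool, (ZMod.stdAddChar (∑ i : Fin N, if x i then β i else 0) : ℂ) *
                (if (OddZeros x ∧ RingHLF.Rel x (fun k => g k x)) then (1 : ℂ) else 0)‖
              ≤ (N : ℝ) ^ A * ((7 + Real.exp (-(3 / (8 * 4 ^ (max w₀ 1))))) / 8) ^
                    ((univ.filter fun i : Fin N => i ∉ W ∧ β i ≠ 0).card / (Nat.log 2 N) ^ C)
                  * (2 : ℝ) ^ N := by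
  classical
  refine ⟨1, 3, fun N hN W T g _hW _hT hw₀ hg β => ?_⟩
  set ρ : ℝ := (7 + Real.exp (-(3 / (8 * 4 ^ (max w₀ 1))))) / 8 with hρ
  have hρ0 : 0 ≤ ρ := le_trans (by norm_num) (rhoSize_ge w₀)
  have hρ1 : ρ ≤ 1 := (rhoSize_lt_one w₀).le
  have hTr : ∀ k, ReadsOnly (T k) (g k) := fun k x x' h => hg k x x' h
  have h := norm_twistedWinSum_le_juntaSize hN W T g hTr hw₀ β
  rw [pow_one]
  refine h.trans ?_
  set P := univ.filter (fun i : Fin N => i ∉ W ∧ β i ≠ 0) with hPdef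
  have hdiv : P.card / (Nat.log 2 N) ^ C ≤ P.card := Nat.div_le_self _ _
  have hpow : ρ ^ P.card ≤ ρ ^ (P.card / (Nat.log 2 N) ^ C) := pow_le_pow_of_le_one hρ0 hρ1 hdiv
  have hN3 : (3 : ℝ) ≤ (N : ℝ) := by exact_mod_cast hN
  have h2 : (0 : ℝ) ≤ (2 : ℝ) ^ N := by positivity
  have hq : (0 : ℝ) ≤ ρ ^ (P.card / (Nat.log 2 N) ^ C) := pow_nonneg hρ0 _
  calc 3 * ρ ^ P.card * (2 : ℝ) ^ N ≤ 3 * ρ ^ (P.card / (Nat.log 2 N) ^ C) * (2 : ℝ) ^ N := by gcongr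
    _ ≤ (N : ℝ) * ρ ^ (P.card / (Nat.log 2 N) ^ C) * (2 : ℝ) ^ N := by nlinarith [mul_nonneg hq h2]

open scoped Classical in
/-- **THE STRUCTURED BRANCH FOR SCATTERED JUNTAS OF BOUNDED SIZE — UNCONDITIONAL** (arbitrary overlaps and multiplicities of the outside
reads): for every `w₀` there are a schedule constant `α` and `θ < 1` such that graded-spread seeds (schedule `(log₂N)^C·(α(j+1) + D·log₂N)`
outside `W`, `3·#W ≤ N`) ⊕ juntas `H k (seed residues) x` reading `T k` with `#(T k ∖ W) ≤ w₀` win on `≤ θ·2^{N−1}` odd inputs, every `C`,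
every number of seeds (`seedJuntaHard_of_restrictedR1` with `ρ = ρ_{w₀}`, `α` from `ρ_{w₀}^α < 1/3`). -/
theorem seedJuntaHardXS_of_juntaSize (w₀ : ℕ) :
    ∃ (α : ℕ) (θ : ℝ), θ < 1 ∧ ∀ C : ℕ, ∃ D n₀ : ℕ, ∀ N ≥ n₀,
      ∀ (W : Finset (Fin N)) (R : ℕ) (c : Fin R → Fin N → ZMod 3) (T : Fin N → Finset (Fin N))
        (H : Fin N → (Fin R → ZMod 3) → (Fin N → Bool) → Bool),
        3 * W.card ≤ N → GradedSpreadOff W c (fun j => (Nat.log 2 N) ^ C * (α * (j.val + 1) + D * Nat.log 2 N)) →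
        (∀ k, (T k \ W).card ≤ (Nat.log 2 N) ^ C) → (∀ k, (T k \ W).card ≤ w₀) →
        (∀ k v (x x' : Fin N → Bool), (∀ i ∈ T k, x i = x' i) → H k v x = H k v x') →
          ((univ.filter fun x : Fin N → Bool =>
              OddZeros x ∧ RingHLF.Rel x (fun k => H k (LinForms.resVec c x) x)).card : ℝ)
            ≤ θ * (2 : ℝ) ^ (N - 1) := by
  set ρ : ℝ := (7 + Real.exp (-(3 / (8 * 4 ^ (max w₀ 1))))) / 8 with hρ
  have hρ0 : 0 ≤ ρ := le_trans (by norm_num) (rhoSize_ge w₀)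
  have hρ1 : ρ < 1 := rhoSize_lt_one w₀
  obtain ⟨α, hα⟩ := exists_pow_lt_of_lt_one (show (0 : ℝ) < 1 / 3 by norm_num) hρ1
  have hq : 3 * ρ ^ α < 1 := by linarith
  obtain ⟨θ, hθ, hmain⟩ := seedJuntaHard_of_restrictedR1
    (fun N W T => ∀ k : Fin N, (T k \ W).card ≤ w₀) hρ0 hq (fun C => twistedJuntaBoundX3S_of_juntaSize w₀ C)
  exact ⟨α, θ, hθ, hmain⟩

end GradedSeeds38

end Summit.QuantumAdvantage.AdviceFreeQNC0

end
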